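import Summits.ABC.IUTFork.LDHSUnitFamilyMixedSum
import HarnessLib

/-!
# The S-unit quadratic family of the `λ`-line: V. Exact heights and the SZPIRO GUARD (plan RULING C-R42 «C:SZPIRO-GUARD-SUNIT», (Q1))

Record-only PROOF file (D-0012) of the abc-iut cell (R2 S-chain team, seat abc-iut-s2-p4 gen 5); TAKES NO SIDE on [IUTchIII] Cor. 3.12,
on [IUTchIV] Thm. 1.10, or on any author. S. Mochizuki, *IUT IV* [Mochizuki2012], Thm. 1.10 pp. 22–23 (`log(𝔮)`, `log(𝔣)`, `d_mod`),
Cor. 2.2 (ii) proof (P5) p. 46 (`𝕍^bad_mod` = bad places not dividing `2l`); [MochizukiGenEll2010] Def. 1.5 (iii) p. 8 (`log-diff`).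
At the points `P_{a,c} = (F_{a,c}, λ_{a,c})` of parts I–IV (`F = ℚ(√D)`, `D = 5^{2a} + 4·7^{2c}`, `λ = θ/7^c`, `θθ' = 5^a7^c`; `j(λ)` has
EXACTLY the poles `2a·𝔭₁ + 2c·𝔮₁ + 2c·𝔮₂` — BOTH places over `7` are bad: `1 − λ = (7^c − θ)/7^c` has a zero of order `c` at `𝔮₁`):
* `badPlaces_eq` (`= {𝔭₁, 𝔮₁, 𝔮₂}`), `badPlacesAvoid_eq`; **`logQAvoid_eq` / `logQForall_eq` / `logQAvoid_two_l_eq`: `log q^{∤S}(λ_{a,c}) =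
  a·log 5 + 2c·log 7`** for every set `S` of primes `∌ 5, 7` (`S = ∅`, `S = {2,l}`); `logQAvoid_le` (every `S`); **`logCondAvoid_eq` /
  `logCondAvoid_two_l_eq`: `log 𝔣_{∤S} = ½(log 5 + 2·log 7)`** (CONSTANT conductor); `logDiff_eq_half_log_discr`: `log-diff = ½·log|disc F_{a,c}|`;
* **`szpiroBad_iff_logDiff_lt` / `szpiroBad_iff_log_discr_lt`** — for a prime `l ≥ 11` the SZPIRO-BAD disjunct of the certificates' `hregBad`
  binder (RESHAPE-4 text VERBATIM) holds at `(P_{a,c}, l)` IFF `log|disc ℚ(√(5^{2a}+4·7^{2c}))| < ((l+4)/(3l))·(a·log 5 + 2c·log 7) −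
  (2(l+5)/(l−3))·log π − (1−1/l)·(log 5 + 2·log 7)`; one-sided: a Szpiro-bad member has `|disc F_{a,c}| < 5^{(1+4/l)·a} ≤ D^{(1+4/l)/2}`
  (`log_discr_lt_of_szpiroBad`, `7^c ≤ 5^a`), and `|disc F_{a,c}| ≤ 5^{(1+4/l)·a}·e^{−c(l)}` makes it Szpiro-bad (`szpiroBad_of_log_discr_le`,
  `5^a ≤ 5^l·7^c`). So **the guard is met at a member iff the squarefree kernel of `D = 5^{2a} + 4·7^{2c}` is below `≈ √D·D^{2/l}`** — a
  «powerful value» event for the `ℤ`-triple `5^{2a} + 4·7^{2c} = D`, not decidable symbolically; generic members are Szpiro-GOOD.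
Consumed by `Conditional/AbcOfSHregBadSzpiroGuardSUnit.lean` ((Q2)). Nothing asserted about Θ-data; no side taken; typed ≠ proved.
[cite: Mochizuki2012, IUTchIV Thm. 1.10 p. 22–23] [cite: Mochizuki2012, IUTchIV Cor. 2.2 (ii) proof (P5) p. 46]
[cite: MochizukiGenEll2010, Def 1.5 (iii) p.8] [claim: Mochizuki2012, status: disputed] for every IUT quotation.
-/


noncomputable section

namespace Summit.ABC.IUTFork.SUnitFamily

open NumberField IsDedekindDomain Literature.IUT.LogVolume Literature.IUT.LogVolume.Cor22
open Literature.NumberTheory.DiophantineGeometry.GenEll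
open scoped Classical

section Point

variable {a c : ℕ} (ha : 1 ≤ a) (hc : 1 ≤ c)
include ha hc

omit ha hc in
/-- `[F_{a,c} : ℚ] = 2`, as a real number. [folklore] -/
theorem degree_Pt_real : ((Pt a c).degree : ℝ) = 2 := by
  rw [show (Pt a c).degree = 2 from finrank_F a c]; norm_num

/-- **`𝕍^bad(P_{a,c}) = {𝔭₁, 𝔮₁, 𝔮₂}`**: the poles of `j(λ_{a,c})` are `𝔭₁ ∣ 5` (order `2a`) and BOTH `𝔮₁, 𝔮₂ ∣ 7` (order `2c` each);
`𝔭₂ ∣ 5` is good. [cite: Mochizuki2012, IUTchIV Cor 2.2 (ii) proof (P5) p.46] [claim: Mochizuki2012, status: disputed] -/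
theorem badPlaces_eq {𝔭₁ 𝔭₂ 𝔮₁ 𝔮₂ : HeightOneSpectrum (𝓞 (F a c))}
    (H₁ : θI a c ∈ 𝔭₁.asIdeal ∧ θI' a c ∉ 𝔭₁.asIdeal ∧ ((5 : ℕ) : 𝓞 (F a c)) ∈ 𝔭₁.asIdeal ∧ ord (F a c) 𝔭₁ (5 : F a c) = 1)
    (H₂ : θI a c ∉ 𝔭₂.asIdeal ∧ θI' a c ∈ 𝔭₂.asIdeal ∧ ((5 : ℕ) : 𝓞 (F a c)) ∈ 𝔭₂.asIdeal ∧ ord (F a c) 𝔭₂ (5 : F a c) = 1)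
    (K₁ : θI a c ∈ 𝔮₁.asIdeal ∧ θI' a c ∉ 𝔮₁.asIdeal ∧ ((7 : ℕ) : 𝓞 (F a c)) ∈ 𝔮₁.asIdeal ∧ ord (F a c) 𝔮₁ (7 : F a c) = 1)
    (K₂ : θI a c ∉ 𝔮₂.asIdeal ∧ θI' a c ∈ 𝔮₂.asIdeal ∧ ((7 : ℕ) : 𝓞 (F a c)) ∈ 𝔮₂.asIdeal ∧ ord (F a c) 𝔮₂ (7 : F a c) = 1) :
    badPlaces (Pt a c) = {𝔭₁, 𝔮₁, 𝔮₂} := by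
  ext v
  constructor
  · intro hv
    have h := badPlaces_subset hc H₁ H₂ K₁ K₂ v hv
    simp only [Finset.mem_insert, Finset.mem_singleton]
    exact h
  · intro hv
    rw [mem_badPlaces_iff_ord_neg]
    simp only [Finset.mem_insert, Finset.mem_singleton] at hv
    rcases hv with rfl | rfl | rfl
    · have e : ord (Pt a c).F v (jInv (Pt a c).x) = -(2 * (a : ℤ)) := (ord_at_p1 hc H₁.2.2.1 H₁.1 H₁.2.1 H₁.2.2.2).1
      rw [e]; omega
    · have e : ord (Pt a c).F v (jInv (Pt a c).x) = -(2 * (c : ℤ)) := ord_at_q1 hc K₁.2.2.1 K₁.2.1 K₁.2.2.2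
      rw [e]; omega
    · have e : ord (Pt a c).F v (jInv (Pt a c).x) = -(2 * (c : ℤ)) := ord_at_q2 hc K₂.2.2.1 K₂.1 K₂.2.2.2
      rw [e]; omega

/-- Away from a set `S` of rational PRIMES containing neither `5` nor `7`, no bad place is removed: the filtered bad set is still
`{𝔭₁, 𝔮₁, 𝔮₂}`. [cite: Mochizuki2012, IUTchIV Cor 2.2 (ii) proof (P5) p.46] [claim: Mochizuki2012, status: disputed] -/
theorem badPlacesAvoid_eq {𝔭₁ 𝔭₂ 𝔮₁ 𝔮₂ : HeightOneSpectrum (𝓞 (F a c))}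
    (H₁ : θI a c ∈ 𝔭₁.asIdeal ∧ θI' a c ∉ 𝔭₁.asIdeal ∧ ((5 : ℕ) : 𝓞 (F a c)) ∈ 𝔭₁.asIdeal ∧ ord (F a c) 𝔭₁ (5 : F a c) = 1)
    (H₂ : θI a c ∉ 𝔭₂.asIdeal ∧ θI' a c ∈ 𝔭₂.asIdeal ∧ ((5 : ℕ) : 𝓞 (F a c)) ∈ 𝔭₂.asIdeal ∧ ord (F a c) 𝔭₂ (5 : F a c) = 1)
    (K₁ : θI a c ∈ 𝔮₁.asIdeal ∧ θI' a c ∉ 𝔮₁.asIdeal ∧ ((7 : ℕ) : 𝓞 (F a c)) ∈ 𝔮₁.asIdeal ∧ ord (F a c) 𝔮₁ (7 : F a c) = 1)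
    (K₂ : θI a c ∉ 𝔮₂.asIdeal ∧ θI' a c ∈ 𝔮₂.asIdeal ∧ ((7 : ℕ) : 𝓞 (F a c)) ∈ 𝔮₂.asIdeal ∧ ord (F a c) 𝔮₂ (7 : F a c) = 1)
    (S : Finset ℕ) (hS : ∀ p ∈ S, p.Prime) (h5 : 5 ∉ S) (h7 : 7 ∉ S) :
    (badPlaces (Pt a c)).filter (fun v => ∀ p ∈ S, ((p : ℕ) : 𝓞 (Pt a c).F) ∉ v.asIdeal) = {𝔭₁, 𝔮₁, 𝔮₂} := by
  haveI : Fact (Nat.Prime 5) := ⟨by norm_num⟩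
  haveI : Fact (Nat.Prime 7) := ⟨by norm_num⟩
  rw [← badPlaces_eq ha hc H₁ H₂ K₁ K₂]
  apply Finset.filter_true_of_mem
  intro v hv p hp
  have hpp : p.Prime := hS p hp
  have hp5 : p ≠ 5 := fun h => h5 (h ▸ hp)
  have hp7 : p ≠ 7 := fun h => h7 (h ▸ hp)
  rcases badPlaces_subset hc H₁ H₂ K₁ K₂ v hv with rfl | rfl | rfl
  · exact SplitDepth.natCast_not_mem_of_prime_ne ⟨v, mem_placesOver_of_natCast_mem 5 v H₁.2.2.1⟩ hpp hp5
  · exact SplitDepth.natCast_not_mem_of_prime_ne ⟨v, mem_placesOver_of_natCast_mem 7 v K₁.2.2.1⟩ hpp hp7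
  · exact SplitDepth.natCast_not_mem_of_prime_ne ⟨v, mem_placesOver_of_natCast_mem 7 v K₂.2.2.1⟩ hpp hp7

omit ha hc in
/-- `{2, l}` consists of primes and contains neither `5` nor `7` (`l ≠ 5, 7` prime). [folklore] -/
theorem two_l_conds {l : ℕ} (hl : l.Prime) (hl5 : l ≠ 5) (hl7 : l ≠ 7) :
    (∀ p ∈ ({2, l} : Finset ℕ), p.Prime) ∧ 5 ∉ ({2, l} : Finset ℕ) ∧ 7 ∉ ({2, l} : Finset ℕ) := by
  refine ⟨fun p hp => ?_, ?_, ?_⟩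
  · simp only [Finset.mem_insert, Finset.mem_singleton] at hp
    rcases hp with rfl | rfl
    · exact Nat.prime_two
    · exact hl
  · simp only [Finset.mem_insert, Finset.mem_singleton, not_or]; exact ⟨by norm_num, fun h => hl5 h.symm⟩
  · simp only [Finset.mem_insert, Finset.mem_singleton, not_or]; exact ⟨by norm_num, fun h => hl7 h.symm⟩

/-- The three-term sum `Σ_{v ∈ {𝔭₁, 𝔮₁, 𝔮₂}} h_v·log N(v) = 2a·log 5 + 4c·log 7`. [cite: Mochizuki2012, IUTchIV Cor 2.2 (i) p.41]
[claim: Mochizuki2012, status: disputed] -/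
theorem sum_three_localHeight_logNorm {𝔭₁ 𝔭₂ 𝔮₁ 𝔮₂ : HeightOneSpectrum (𝓞 (F a c))}
    (H₁ : θI a c ∈ 𝔭₁.asIdeal ∧ θI' a c ∉ 𝔭₁.asIdeal ∧ ((5 : ℕ) : 𝓞 (F a c)) ∈ 𝔭₁.asIdeal ∧ ord (F a c) 𝔭₁ (5 : F a c) = 1)
    (H₂ : θI a c ∉ 𝔭₂.asIdeal ∧ θI' a c ∈ 𝔭₂.asIdeal ∧ ((5 : ℕ) : 𝓞 (F a c)) ∈ 𝔭₂.asIdeal ∧ ord (F a c) 𝔭₂ (5 : F a c) = 1)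
    (K₁ : θI a c ∈ 𝔮₁.asIdeal ∧ θI' a c ∉ 𝔮₁.asIdeal ∧ ((7 : ℕ) : 𝓞 (F a c)) ∈ 𝔮₁.asIdeal ∧ ord (F a c) 𝔮₁ (7 : F a c) = 1)
    (K₂ : θI a c ∉ 𝔮₂.asIdeal ∧ θI' a c ∈ 𝔮₂.asIdeal ∧ ((7 : ℕ) : 𝓞 (F a c)) ∈ 𝔮₂.asIdeal ∧ ord (F a c) 𝔮₂ (7 : F a c) = 1) :
    ∑ v ∈ ({𝔭₁, 𝔮₁, 𝔮₂} : Finset (HeightOneSpectrum (𝓞 (Pt a c).F))), localHeight (Pt a c) v * logNorm (Pt a c).F v =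
      2 * (a : ℝ) * Real.log 5 + 4 * (c : ℝ) * Real.log 7 := by
  haveI : Fact (Nat.Prime 5) := ⟨by norm_num⟩
  haveI : Fact (Nat.Prime 7) := ⟨by norm_num⟩
  have hbad := badPlaces_eq ha hc H₁ H₂ K₁ K₂
  -- the three places are distinct
  have h57 : 𝔭₁ ≠ 𝔮₁ ∧ 𝔭₁ ≠ 𝔮₂ := by
    have h7 : ((7 : ℕ) : 𝓞 (F a c)) ∉ 𝔭₁.asIdeal :=
      SplitDepth.natCast_not_mem_of_prime_ne ⟨𝔭₁, mem_placesOver_of_natCast_mem 5 𝔭₁ H₁.2.2.1⟩ (by norm_num) (by norm_num)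
    exact ⟨fun h => h7 (h ▸ K₁.2.2.1), fun h => h7 (h ▸ K₂.2.2.1)⟩
  have hqq : 𝔮₁ ≠ 𝔮₂ := fun h => K₂.1 (h ▸ K₁.1)
  rw [Finset.sum_insert (by simp [h57.1, h57.2]), Finset.sum_pair hqq]
  have m1 : 𝔭₁ ∈ badPlaces (Pt a c) := by rw [hbad]; simp
  have m2 : 𝔮₁ ∈ badPlaces (Pt a c) := by rw [hbad]; simp
  have m3 : 𝔮₂ ∈ badPlaces (Pt a c) := by rw [hbad]; simp
  rw [localHeight_eq_neg_ord m1, localHeight_eq_neg_ord m2, localHeight_eq_neg_ord m3]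
  have o1 : ord (Pt a c).F 𝔭₁ (jInv (Pt a c).x) = -(2 * (a : ℤ)) := (ord_at_p1 hc H₁.2.2.1 H₁.1 H₁.2.1 H₁.2.2.2).1
  have o2 : ord (Pt a c).F 𝔮₁ (jInv (Pt a c).x) = -(2 * (c : ℤ)) := ord_at_q1 hc K₁.2.2.1 K₁.2.1 K₁.2.2.2
  have o3 : ord (Pt a c).F 𝔮₂ (jInv (Pt a c).x) = -(2 * (c : ℤ)) := ord_at_q2 hc K₂.2.2.1 K₂.1 K₂.2.2.2
  rw [o1, o2, o3]
  have e5 : logNorm (F a c) 𝔭₁ = Real.log 5 := (weight_pair_eq_half (p := 5) H₁.1 H₂.1 H₁.2.2.1 H₂.2.2.1).1.2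
  have e7 := weight_pair_eq_half (p := 7) K₁.1 K₂.1 K₁.2.2.1 K₂.2.2.1
  have e71 : logNorm (F a c) 𝔮₁ = Real.log 7 := e7.1.2
  have e72 : logNorm (F a c) 𝔮₂ = Real.log 7 := e7.2.2
  change -((-(2 * (a : ℤ)) : ℤ) : ℝ) * logNorm (F a c) 𝔭₁ +
      (-((-(2 * (c : ℤ)) : ℤ) : ℝ) * logNorm (F a c) 𝔮₁ + -((-(2 * (c : ℤ)) : ℤ) : ℝ) * logNorm (F a c) 𝔮₂) = _
  rw [e5, e71, e72]
  push_cast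
  ring

/-- **`log q^{∤S}(λ_{a,c}) = a·log 5 + 2c·log 7`** for every finite set `S` of rational primes containing neither `5` nor `7`
(`[F:ℚ] = 2`; poles `2a·𝔭₁ + 2c·𝔮₁ + 2c·𝔮₂`, `N𝔭₁ = 5`, `N𝔮ᵢ = 7`). [cite: Mochizuki2012, IUTchIV Cor 2.2 (i) p.41]
[claim: Mochizuki2012, status: disputed] -/
theorem logQAvoid_eq (S : Finset ℕ) (hS : ∀ p ∈ S, p.Prime) (h5 : 5 ∉ S) (h7 : 7 ∉ S) :
    logQAvoid (Pt a c) S = (a : ℝ) * Real.log 5 + 2 * (c : ℝ) * Real.log 7 := by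
  obtain ⟨𝔭₁, 𝔭₂, 𝔮₁, 𝔮₂, H₁, H₂, K₁, K₂⟩ := exists_four_places ha hc
  have h := degree_mul_logQAvoid (Pt a c) S
  rw [badPlacesAvoid_eq ha hc H₁ H₂ K₁ K₂ S hS h5 h7, sum_three_localHeight_logNorm ha hc H₁ H₂ K₁ K₂] at h
  have hdeg : ((Pt a c).degree : ℝ) = 2 := degree_Pt_real
  rw [hdeg] at h
  linarith

/-- **`log q^∀(λ_{a,c}) = a·log 5 + 2c·log 7`.** [cite: Mochizuki2012, IUTchIV Cor 2.2 (i) p.41] [claim: Mochizuki2012, status: disputed] -/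
theorem logQForall_eq : logQForall (Pt a c) = (a : ℝ) * Real.log 5 + 2 * (c : ℝ) * Real.log 7 :=
  logQAvoid_eq ha hc ∅ (fun _ h => absurd h (Finset.notMem_empty _)) (Finset.notMem_empty _) (Finset.notMem_empty _)

/-- **`log q^{∤{2,l}}(λ_{a,c}) = a·log 5 + 2c·log 7`** for every prime `l ∉ {5, 7}` ((P5)'s `𝕍^bad_mod`, `S = {2, l}`).
[cite: Mochizuki2012, IUTchIV Cor 2.2 (ii) proof (P5) p.46] [claim: Mochizuki2012, status: disputed] -/
theorem logQAvoid_two_l_eq {l : ℕ} (hl : l.Prime) (hl5 : l ≠ 5) (hl7 : l ≠ 7) :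
    logQAvoid (Pt a c) {2, l} = (a : ℝ) * Real.log 5 + 2 * (c : ℝ) * Real.log 7 :=
  logQAvoid_eq ha hc {2, l} (two_l_conds hl hl5 hl7).1 (two_l_conds hl hl5 hl7).2.1 (two_l_conds hl hl5 hl7).2.2

/-- **`log q^{∤S}(λ_{a,c}) ≤ a·log 5 + 2c·log 7` for EVERY `S`** (an `S` meeting `5` or `7` only removes poles).
[cite: Mochizuki2012, IUTchIV Cor 2.2 (i) p.41] [claim: Mochizuki2012, status: disputed] -/
theorem logQAvoid_le (S : Finset ℕ) : logQAvoid (Pt a c) S ≤ (a : ℝ) * Real.log 5 + 2 * (c : ℝ) * Real.log 7 := by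
  obtain ⟨𝔭₁, 𝔭₂, 𝔮₁, 𝔮₂, H₁, H₂, K₁, K₂⟩ := exists_four_places ha hc
  have h := degree_mul_logQAvoid (Pt a c) S
  have hsub : (badPlaces (Pt a c)).filter (fun v => ∀ p ∈ S, ((p : ℕ) : 𝓞 (Pt a c).F) ∉ v.asIdeal) ⊆ {𝔭₁, 𝔮₁, 𝔮₂} := by
    intro v hv
    rw [← badPlaces_eq ha hc H₁ H₂ K₁ K₂]
    exact Finset.mem_of_mem_filter v hv
  have hle := Finset.sum_le_sum_of_subset_of_nonneg hsub
    (fun v _ _ => mul_nonneg (localHeight_nonneg (Pt a c) v) (logNorm_pos (Pt a c).F v).le)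
  rw [sum_three_localHeight_logNorm ha hc H₁ H₂ K₁ K₂, ← h] at hle
  have hdeg : ((Pt a c).degree : ℝ) = 2 := degree_Pt_real
  rw [hdeg] at hle
  linarith

/-- **`log 𝔣^{F_tpd}_{∤S}(P_{a,c}) = ½(log 5 + 2·log 7)`** for every finite set `S` of rational primes containing neither `5` nor `7`: the
conductor is CONSTANT along the family. [cite: Mochizuki2012, IUTchIV Thm 1.10 p.23] [claim: Mochizuki2012, status: disputed] -/
theorem logCondAvoid_eq (S : Finset ℕ) (hS : ∀ p ∈ S, p.Prime) (h5 : 5 ∉ S) (h7 : 7 ∉ S) :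
    logCondAvoid (Pt a c) S = (Real.log 5 + 2 * Real.log 7) / 2 := by
  haveI : Fact (Nat.Prime 5) := ⟨by norm_num⟩
  haveI : Fact (Nat.Prime 7) := ⟨by norm_num⟩
  obtain ⟨𝔭₁, 𝔭₂, 𝔮₁, 𝔮₂, H₁, H₂, K₁, K₂⟩ := exists_four_places ha hc
  rw [logCondAvoid_eq_sum]
  have hdeg : ((Pt a c).degree : ℝ) = 2 := degree_Pt_real
  rw [hdeg]
  have hset : badPlacesAvoid (Pt a c) S = {𝔭₁, 𝔮₁, 𝔮₂} := badPlacesAvoid_eq ha hc H₁ H₂ K₁ K₂ S hS h5 h7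
  rw [hset]
  have h57 : 𝔭₁ ≠ 𝔮₁ ∧ 𝔭₁ ≠ 𝔮₂ := by
    have h7' : ((7 : ℕ) : 𝓞 (F a c)) ∉ 𝔭₁.asIdeal :=
      SplitDepth.natCast_not_mem_of_prime_ne ⟨𝔭₁, mem_placesOver_of_natCast_mem 5 𝔭₁ H₁.2.2.1⟩ (by norm_num) (by norm_num)
    exact ⟨fun h => h7' (h ▸ K₁.2.2.1), fun h => h7' (h ▸ K₂.2.2.1)⟩
  have hqq : 𝔮₁ ≠ 𝔮₂ := fun h => K₂.1 (h ▸ K₁.1)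
  rw [Finset.sum_insert (by simp [h57.1, h57.2]), Finset.sum_pair hqq]
  have e5 : logNorm (F a c) 𝔭₁ = Real.log 5 := (weight_pair_eq_half (p := 5) H₁.1 H₂.1 H₁.2.2.1 H₂.2.2.1).1.2
  have e7 := weight_pair_eq_half (p := 7) K₁.1 K₂.1 K₁.2.2.1 K₂.2.2.1
  unfold logNorm at e5 e7
  rw [e5, e7.1.2, e7.2.2]
  ring

/-- **`log 𝔣^{F_tpd}_{∤{2,l}}(P_{a,c}) = ½(log 5 + 2·log 7)`** for every prime `l ∉ {5, 7}`.
[cite: Mochizuki2012, IUTchIV Cor 2.2 (ii) proof (P5) p.46] [claim: Mochizuki2012, status: disputed] -/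
theorem logCondAvoid_two_l_eq {l : ℕ} (hl : l.Prime) (hl5 : l ≠ 5) (hl7 : l ≠ 7) :
    logCondAvoid (Pt a c) {2, l} = (Real.log 5 + 2 * Real.log 7) / 2 :=
  logCondAvoid_eq ha hc {2, l} (two_l_conds hl hl5 hl7).1 (two_l_conds hl hl5 hl7).2.1 (two_l_conds hl hl5 hl7).2.2

end Point

/-- **`log-diff(P_{a,c}) = ½·log|disc F_{a,c}|`** ([GenEll] Def. 1.5 (iii); `[F:ℚ] = 2`). [cite: MochizukiGenEll2010, Def 1.5 (iii) p.8] -/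
theorem logDiff_eq_half_log_discr (a c : ℕ) :
    (Pt a c).logDiff = Real.log ((NumberField.discr (F a c)).natAbs : ℝ) / 2 := by
  rw [NFPoint.logDiff_eq_log_discr]
  have : (Pt a c).degree = 2 := finrank_F a c
  rw [this]
  push_cast
  ring


/-! ## The SZPIRO GUARD at `(P_{a,c}, l)` (C-R42 (Q1)): the certificates' Szpiro-bad disjunct ⟺ a small field discriminant -/

section Guard

variable {a c : ℕ} (ha : 1 ≤ a) (hc : 1 ≤ c) {l : ℕ} (hl : l.Prime) (h11 : 11 ≤ l)
include ha hc hl h11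

/-- **THE SZPIRO GUARD, EXACTLY (C-R42 (Q1)).** For a prime `l ≥ 11`, the SZPIRO-BAD disjunct of the RESHAPE-4 cone binder `hregBad`
(abc-iut-s2-p2 p452755 / the certificates' `hreg ↦ hregBad`; text VERBATIM: `(l+5)/4 < d_mod ∨ 6l((l+5) − 4d_mod)/((l+4)(l−3))·(log-diff +
(1 − 1/l)·log-cond) + 6l(l+5)/((l+4)(l−3))·log π < log q^{∤{2,l}}(λ)`) holds at `(P_{a,c}, l)` IF AND ONLY IF
`log-diff(P_{a,c}) < ((l+4)/(6l))·(a·log 5 + 2c·log 7) − ((l+5)/(l−3))·log π − (1 − 1/l)·½(log 5 + 2·log 7)`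
(`d_mod = 2` kills the first disjunct; `log q^{∤{2,l}} = a·log 5 + 2c·log 7`, `log 𝔣 = ½(log 5 + 2 log 7)` exactly).
[cite: Mochizuki2012, IUTchIV Thm. 1.10 p. 22–23] [claim: Mochizuki2012, status: disputed] -/
theorem szpiroBad_iff_logDiff_lt :
    (((l : ℝ) + 5) / 4 < (dmod (Pt a c) : ℝ) ∨
      6 * l * (((l : ℝ) + 5) - 4 * dmod (Pt a c)) / (((l : ℝ) + 4) * ((l : ℝ) - 3))
          * ((Pt a c).logDiff + (1 - 1 / (l : ℝ)) * logCondAvoid (Pt a c) {2, l})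
        + 6 * l * ((l : ℝ) + 5) / (((l : ℝ) + 4) * ((l : ℝ) - 3)) * Real.log Real.pi < logQAvoid (Pt a c) {2, l}) ↔
    (Pt a c).logDiff < ((l : ℝ) + 4) / (6 * l) * ((a : ℝ) * Real.log 5 + 2 * (c : ℝ) * Real.log 7)
      - ((l : ℝ) + 5) / ((l : ℝ) - 3) * Real.log Real.pi - (1 - 1 / (l : ℝ)) * ((Real.log 5 + 2 * Real.log 7) / 2) := by
  have hl5 : l ≠ 5 := by omega
  have hl7 : l ≠ 7 := by omega
  have hd : (dmod (Pt a c) : ℝ) = 2 := by rw [dmod_P ha hc]; norm_num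
  have hQ := logQAvoid_two_l_eq ha hc hl hl5 hl7
  have hC := logCondAvoid_two_l_eq ha hc hl hl5 hl7
  have hlr : (11 : ℝ) ≤ (l : ℝ) := by exact_mod_cast h11
  have h0 : (l : ℝ) ≠ 0 := by positivity
  have h3 : (l : ℝ) - 3 ≠ 0 := ne_of_gt (by linarith)
  have h4 : (l : ℝ) + 4 ≠ 0 := ne_of_gt (by linarith)
  have hA : 0 < 6 * (l : ℝ) / ((l : ℝ) + 4) := by positivity
  have key : logQAvoid (Pt a c) {2, l} -
        (6 * l * (((l : ℝ) + 5) - 4 * dmod (Pt a c)) / (((l : ℝ) + 4) * ((l : ℝ) - 3))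
            * ((Pt a c).logDiff + (1 - 1 / (l : ℝ)) * logCondAvoid (Pt a c) {2, l})
          + 6 * l * ((l : ℝ) + 5) / (((l : ℝ) + 4) * ((l : ℝ) - 3)) * Real.log Real.pi) =
      6 * (l : ℝ) / ((l : ℝ) + 4) *
        ((((l : ℝ) + 4) / (6 * l) * ((a : ℝ) * Real.log 5 + 2 * (c : ℝ) * Real.log 7)
          - ((l : ℝ) + 5) / ((l : ℝ) - 3) * Real.log Real.pi - (1 - 1 / (l : ℝ)) * ((Real.log 5 + 2 * Real.log 7) / 2))
          - (Pt a c).logDiff) := by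
    rw [hd, hQ, hC]
    field_simp
    ring
  constructor
  · rintro (h1 | h2)
    · exfalso; rw [hd] at h1; linarith
    · have h' : 0 < 6 * (l : ℝ) / ((l : ℝ) + 4) *
          ((((l : ℝ) + 4) / (6 * l) * ((a : ℝ) * Real.log 5 + 2 * (c : ℝ) * Real.log 7)
            - ((l : ℝ) + 5) / ((l : ℝ) - 3) * Real.log Real.pi - (1 - 1 / (l : ℝ)) * ((Real.log 5 + 2 * Real.log 7) / 2))
            - (Pt a c).logDiff) := by
        rw [← key]; linarith
      have := (mul_pos_iff_of_pos_left hA).mp h'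
      linarith
  · intro h
    right
    have h' : 0 < 6 * (l : ℝ) / ((l : ℝ) + 4) *
        ((((l : ℝ) + 4) / (6 * l) * ((a : ℝ) * Real.log 5 + 2 * (c : ℝ) * Real.log 7)
          - ((l : ℝ) + 5) / ((l : ℝ) - 3) * Real.log Real.pi - (1 - 1 / (l : ℝ)) * ((Real.log 5 + 2 * Real.log 7) / 2))
          - (Pt a c).logDiff) := mul_pos hA (by linarith)
    rw [← key] at h'
    linarith

/-- **THE GUARD IN TERMS OF THE FIELD DISCRIMINANT.** Szpiro-bad at `(P_{a,c}, l)` ⟺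
`log|disc ℚ(√(5^{2a} + 4·7^{2c}))| < ((l+4)/(3l))·(a·log 5 + 2c·log 7) − (2(l+5)/(l−3))·log π − (1 − 1/l)·(log 5 + 2·log 7)`.
[cite: MochizukiGenEll2010, Def 1.5 (iii) p.8] [claim: Mochizuki2012, status: disputed] -/
theorem szpiroBad_iff_log_discr_lt :
    (((l : ℝ) + 5) / 4 < (dmod (Pt a c) : ℝ) ∨
      6 * l * (((l : ℝ) + 5) - 4 * dmod (Pt a c)) / (((l : ℝ) + 4) * ((l : ℝ) - 3))
          * ((Pt a c).logDiff + (1 - 1 / (l : ℝ)) * logCondAvoid (Pt a c) {2, l})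
        + 6 * l * ((l : ℝ) + 5) / (((l : ℝ) + 4) * ((l : ℝ) - 3)) * Real.log Real.pi < logQAvoid (Pt a c) {2, l}) ↔
    Real.log ((NumberField.discr (F a c)).natAbs : ℝ) <
      ((l : ℝ) + 4) / (3 * l) * ((a : ℝ) * Real.log 5 + 2 * (c : ℝ) * Real.log 7)
        - 2 * ((l : ℝ) + 5) / ((l : ℝ) - 3) * Real.log Real.pi - (1 - 1 / (l : ℝ)) * (Real.log 5 + 2 * Real.log 7) := by
  rw [szpiroBad_iff_logDiff_lt ha hc hl h11, logDiff_eq_half_log_discr]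
  have hlr : (11 : ℝ) ≤ (l : ℝ) := by exact_mod_cast h11
  have h0 : (l : ℝ) ≠ 0 := by positivity
  have h3 : (l : ℝ) - 3 ≠ 0 := ne_of_gt (by linarith)
  have e : ((l : ℝ) + 4) / (3 * l) * ((a : ℝ) * Real.log 5 + 2 * (c : ℝ) * Real.log 7)
        - 2 * ((l : ℝ) + 5) / ((l : ℝ) - 3) * Real.log Real.pi - (1 - 1 / (l : ℝ)) * (Real.log 5 + 2 * Real.log 7) =
      2 * (((l : ℝ) + 4) / (6 * l) * ((a : ℝ) * Real.log 5 + 2 * (c : ℝ) * Real.log 7)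
        - ((l : ℝ) + 5) / ((l : ℝ) - 3) * Real.log Real.pi - (1 - 1 / (l : ℝ)) * ((Real.log 5 + 2 * Real.log 7) / 2)) := by
    field_simp
    ring
  rw [e]
  constructor <;> intro h <;> linarith

/-- **NECESSARY SIDE: a Szpiro-bad member has `|disc F_{a,c}| < 5^{(1+4/l)·a} ≤ D^{(1+4/l)/2}`** (`7^c ≤ 5^a`, so `2c·log 7 ≤ 2a·log 5` and
`D = 5^{2a} + 4·7^{2c} ≥ 5^{2a}`): the squarefree kernel of `D` must be below `≈ √D·D^{2/l}` — a «powerful value» of the `ℤ`-triple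
`5^{2a} + 4·7^{2c} = D`. [cite: MochizukiGenEll2010, Def 1.5 (iii) p.8] [claim: Mochizuki2012, status: disputed] -/
theorem log_discr_lt_of_szpiroBad (hlo : 7 ^ c ≤ 5 ^ a)
    (hbad : ((l : ℝ) + 5) / 4 < (dmod (Pt a c) : ℝ) ∨
      6 * l * (((l : ℝ) + 5) - 4 * dmod (Pt a c)) / (((l : ℝ) + 4) * ((l : ℝ) - 3))
          * ((Pt a c).logDiff + (1 - 1 / (l : ℝ)) * logCondAvoid (Pt a c) {2, l})
        + 6 * l * ((l : ℝ) + 5) / (((l : ℝ) + 4) * ((l : ℝ) - 3)) * Real.log Real.pi < logQAvoid (Pt a c) {2, l}) :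
    Real.log ((NumberField.discr (F a c)).natAbs : ℝ) < (1 + 4 / (l : ℝ)) * ((a : ℝ) * Real.log 5) := by
  rw [szpiroBad_iff_log_discr_lt ha hc hl h11] at hbad
  have hlr : (11 : ℝ) ≤ (l : ℝ) := by exact_mod_cast h11
  have h0 : (0 : ℝ) < (l : ℝ) := by linarith
  have hlog5 : 0 < Real.log 5 := Real.log_pos (by norm_num)
  have hlog7 : 0 < Real.log 7 := Real.log_pos (by norm_num)
  have hlogpi : 0 < Real.log Real.pi := Real.log_pos (by linarith [Real.pi_gt_three])
  have hcl : (c : ℝ) * Real.log 7 ≤ (a : ℝ) * Real.log 5 := by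
    have h := Real.log_le_log (by positivity) (show ((7 : ℝ) ^ c) ≤ (5 : ℝ) ^ a by exact_mod_cast hlo)
    rwa [Real.log_pow, Real.log_pow] at h
  have h1 : ((l : ℝ) + 4) / (3 * l) * ((a : ℝ) * Real.log 5 + 2 * (c : ℝ) * Real.log 7) ≤ (1 + 4 / (l : ℝ)) * ((a : ℝ) * Real.log 5) := by
    have e : (1 + 4 / (l : ℝ)) * ((a : ℝ) * Real.log 5) = ((l : ℝ) + 4) / (3 * l) * (3 * ((a : ℝ) * Real.log 5)) := by
      field_simp
    rw [e]
    exact mul_le_mul_of_nonneg_left (by linarith) (by positivity)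
  have h2 : 0 ≤ 2 * ((l : ℝ) + 5) / ((l : ℝ) - 3) * Real.log Real.pi := by
    have : (0 : ℝ) < (l : ℝ) - 3 := by linarith
    positivity
  have h3 : 0 ≤ (1 - 1 / (l : ℝ)) * (Real.log 5 + 2 * Real.log 7) := by
    have : 0 ≤ 1 - 1 / (l : ℝ) := by
      rw [sub_nonneg, div_le_one h0]; linarith
    positivity
  linarith

/-- **SUFFICIENT SIDE: `|disc F_{a,c}| ≤ 5^{(1+4/l)·a}·e^{−c(l)}`, `c(l) = ((2l+8)/3)·log 5 + log 5 + 2·log 7 + 8`, makes `(P_{a,c}, l)`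
Szpiro-bad** (for the family index `5^a ≤ 5^l·7^c`, so `2c·log 7 ≥ 2a·log 5 − 2l·log 5`; `log π < 2`, `2(l+5)/(l−3) ≤ 4` for `l ≥ 11`).
Neither side is asserted to be inhabited: whether `D = 5^{2a} + 4·7^{2c}` takes such powerful values infinitely often along `l ∤ a, c` is an
abc-type question. [cite: MochizukiGenEll2010, Def 1.5 (iii) p.8] [claim: Mochizuki2012, status: disputed] -/
theorem szpiroBad_of_log_discr_le (hhi : 5 ^ a ≤ 5 ^ l * 7 ^ c)
    (hdisc : Real.log ((NumberField.discr (F a c)).natAbs : ℝ) ≤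
      (1 + 4 / (l : ℝ)) * ((a : ℝ) * Real.log 5) - (2 * ((l : ℝ) + 4) / 3 * Real.log 5 + (Real.log 5 + 2 * Real.log 7) + 8)) :
    ((l : ℝ) + 5) / 4 < (dmod (Pt a c) : ℝ) ∨
      6 * l * (((l : ℝ) + 5) - 4 * dmod (Pt a c)) / (((l : ℝ) + 4) * ((l : ℝ) - 3))
          * ((Pt a c).logDiff + (1 - 1 / (l : ℝ)) * logCondAvoid (Pt a c) {2, l})
        + 6 * l * ((l : ℝ) + 5) / (((l : ℝ) + 4) * ((l : ℝ) - 3)) * Real.log Real.pi < logQAvoid (Pt a c) {2, l} := by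
  rw [szpiroBad_iff_log_discr_lt ha hc hl h11]
  have hlr : (11 : ℝ) ≤ (l : ℝ) := by exact_mod_cast h11
  have h0 : (0 : ℝ) < (l : ℝ) := by linarith
  have hlog5 : 0 < Real.log 5 := Real.log_pos (by norm_num)
  have hlog7 : 0 < Real.log 7 := Real.log_pos (by norm_num)
  have hlogpi0 : 0 < Real.log Real.pi := Real.log_pos (by linarith [Real.pi_gt_three])
  -- `log π < 2`: `π ≤ 4 < e²`
  have hlogpi : Real.log Real.pi < 2 := by
    rw [Real.log_lt_iff_lt_exp Real.pi_pos]
    have h4 : Real.pi ≤ 4 := Real.pi_le_four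
    have he : (4 : ℝ) < Real.exp 2 := by
      have h1 := Real.exp_one_gt_d9
      have e2 : Real.exp 2 = Real.exp 1 * Real.exp 1 := by rw [← Real.exp_add]; norm_num
      rw [e2]; nlinarith
    linarith
  -- `c·log 7 ≥ a·log 5 − l·log 5`
  have hcl : (a : ℝ) * Real.log 5 ≤ (l : ℝ) * Real.log 5 + (c : ℝ) * Real.log 7 := by
    have h := Real.log_le_log (by positivity) (show ((5 : ℝ) ^ a) ≤ (5 : ℝ) ^ l * (7 : ℝ) ^ c by exact_mod_cast hhi)
    rw [Real.log_mul (by positivity) (by positivity), Real.log_pow, Real.log_pow, Real.log_pow] at h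
    linarith
  -- the coefficient bounds at `l ≥ 11`
  have hk1 : 2 * ((l : ℝ) + 5) / ((l : ℝ) - 3) ≤ 4 := by
    rw [div_le_iff₀ (by linarith)]; linarith
  have hk2 : 0 ≤ 1 - 1 / (l : ℝ) := by rw [sub_nonneg, div_le_one h0]; linarith
  have hk3 : 1 - 1 / (l : ℝ) ≤ 1 := by
    have : 0 ≤ 1 / (l : ℝ) := by positivity
    linarith
  -- lower bound for the threshold
  have hQ : ((l : ℝ) + 4) / (3 * l) * (3 * ((a : ℝ) * Real.log 5) - 2 * (l : ℝ) * Real.log 5) ≤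
      ((l : ℝ) + 4) / (3 * l) * ((a : ℝ) * Real.log 5 + 2 * (c : ℝ) * Real.log 7) :=
    mul_le_mul_of_nonneg_left (by linarith) (by positivity)
  have e1 : ((l : ℝ) + 4) / (3 * l) * (3 * ((a : ℝ) * Real.log 5) - 2 * (l : ℝ) * Real.log 5) =
      (1 + 4 / (l : ℝ)) * ((a : ℝ) * Real.log 5) - 2 * ((l : ℝ) + 4) / 3 * Real.log 5 := by
    field_simp
  have hπ : 2 * ((l : ℝ) + 5) / ((l : ℝ) - 3) * Real.log Real.pi < 8 := by
    have hpos : 0 < 2 * ((l : ℝ) + 5) / ((l : ℝ) - 3) := by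
      have : (0 : ℝ) < (l : ℝ) - 3 := by linarith
      positivity
    have := mul_lt_mul_of_pos_left hlogpi hpos
    linarith
  have hC : (1 - 1 / (l : ℝ)) * (Real.log 5 + 2 * Real.log 7) ≤ Real.log 5 + 2 * Real.log 7 := by
    have : 0 < Real.log 5 + 2 * Real.log 7 := by positivity
    nlinarith
  rw [e1] at hQ
  linarith

end Guard

end Summit.ABC.IUTFork.SUnitFamily

end
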